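import Mathlib
import Literature.MathematicalPhysics.QuantumFieldTheory.MagnenRivasseauSeneor1993.MRS93LargeFieldRegions
import Literature.MathematicalPhysics.QuantumFieldTheory.MagnenRivasseauSeneor1993.MRS93PositionSpaceFields
import HarnessLib

/-!
# Magnen–Rivasseau–Sénéor, *Construction of YM₄ with an infrared cutoff* (CMP 155, 1993), §II.B (II.26) p.335 —
# the small-field functional `E_Δ` OF THE CUT-OFF FIELD IN POSITION SPACE: the slice `A^{i,α} = κ̃^{i,α} ∗ A` of
# (II.23) as a field on Λ, `E_Δ(A) = (1/|Δ|)∫_Δ((λ_i^t)^{1/2+ε₁}M^{−i}|A^{i,α}(x)|)^{P_i} d⁴x` as a measurable functional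
# of the configuration, and (II.35) with THIS `E_Δ`

statement-level bookkeeping of a published definition with citation tags; measurability/continuity PROVED; nothing here is
a claim about the Yang–Mills mass gap, about continuum Yang–Mills on `T⁴` without infrared cutoff, or about the Clay
problem — and nothing of Magnen–Rivasseau–Sénéor's expansions or estimates is asserted or formalised

**Citation header (reproduction of PUBLISHED work).** J. Magnen, V. Rivasseau, R. Sénéor, *Construction of YM₄ with an
infrared cutoff*, Commun. Math. Phys. **155** (1993) 325–383 [MagnenRivasseauSeneor1993], Sect. II.B p.335. Loci
`p.NNN tl.nn` = journal page and text-layer line of the held scan `paper:magnen1993-cmp155-mrs-ym4-infrared-cutoff`;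
(II.23) and (II.25)–(II.26) were read on the page image of record `renders-cmp155/p11_full_s6.png`
(`run/shared/lean/pub/lit-balaban/inprint/lit-balaban-p14/`). Cell pub-balaban-gaps (YM blitz, track G3), seat
mrs-lit-1 (statement layer), gen 17; companion record `run/shared/lean/pub/pub-balaban-gaps/g3/MRS-AS-PRINTED.md`.
Sibling modules used BY NAME, nothing re-typed: `…MRS93LargeFieldRegions` (this seat, gen 17: `BoxLabel`, `Ebox`,
`chiLFR`, `Σ_LFR χ_LFR ≡ 1`, (II.35) for abstract box functionals), `…MRS93PositionSpaceFields` (this seat, gen 9: `Pos`,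
`field`, `chi`), `…MRS93AnisotropicSlicing` (gen 2: `MainStatement.sliceField` = the momentum-space block `κ̃^{i,α} ∗ A`
of (II.23), `fieldDecomposition`), `…MRS93PhaseCells` (gen 0: `anisoBox`, `smallFieldE`), `…MRS93AxialYMAction`
(`coeff`, `ymFactor`), `…MRS93GaussianReferenceMeasures` (`muZero`).

**What the paper prints (verbatim, page image p.335).** (II.23) tl.12–15: *«We decompose the field in direct space as
follows: A = Σ_𝐏 κ̃^{i,α} ∗ A ≡ Σ_{j∈𝐏} A^j (II.23) (where the tilde means the Fourier transform).»*; (II.25)–(II.26)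
tl.20–24: *«In each box Δ ∈ 𝐃 we write the expansion: 1 = e^{−E_Δ} + ∫₀¹ ds E_Δ e^{−(1−s)E_Δ}, (II.25) where:
E_Δ = (1/Δ) ∫_Δ ((λ_i^t)^{1/2+ε₁} M^{−i} κ̃^{i,α} ∗ A)^{P_i}, (II.26) where P_i = (λ_i^t)^{−ε₁/2}.»*; (II.35) p.339
tl.11–14 (quoted in `…MRS93LargeFieldRegions`).

**What is typed here (0 `sorry`, 0 new named facts; every theorem kernel-checked).** `…MRS93PhaseCells` typed (II.26)
«over an ABSTRACT smeared field (`κ̃^{i,α} ∗ A` … not constructed)» and `…MRS93LargeFieldRegions` kept `E_Δ` abstract;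
this leaf supplies the PRINTED `E_Δ` of the cut-off field:
* §1 `toPos : ℝ⁴ → Pos` — period-`1` coordinates of `Λ = ℝ⁴/ℤ⁴` (p.328 tl.8; the boxes are «refinements of a fixed
  lattice at the unit scale», p.335 tl.18–19) into the period-`2π` model of `…PositionSpaceFields`; `continuous_toPos`,
  `toPos_add_intCast` (ℤ⁴-periodicity).
* §2 **`slicePos par N S i α A μ a x`** `= Σ_{p∈S} κ^{i,α}(|p|,|p₀|) Ã^a_μ(p) e^{ip·x}` — the block `A^{i,α} = κ̃^{i,α} ∗ A`
  of (II.23) AS A FIELD ON Λ (Fourier synthesis of gen 2's momentum-space block); `continuous_slicePos`,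
  **`continuous_slicePos_uncurry`** (joint continuity in `(A, x)`), **`field_fieldDecomposition`** ((II.23) in position
  space: `A(x) = Σ_{j∈𝐏} A^j(x)` for the synthesised `fieldDecomposition`).
* §2b reality: `coeff_sliceField` (`(A^j)~(p) = κ^{i,α}·Ã(p)`), `isRealOn_sliceField`, **`conj_slicePos`** / `slicePos_im` —
  the slice of a cut-off configuration obeying `Ã(−p) = conj Ã(p)` (a.e. under `dμ_{0,ρ₁}`, gen 9) is a REAL field on Λ.
* §3 READING (N): `sliceNormSqPos` / **`sliceNormPos`** `= |A^{i,α}(x)| := (½ Σ_μ Σ_a |A^{i,α,a}_μ(x)|²)^{1/2}` (the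
  printed scalar product's pointwise norm; (II.26) raises the multiplet to `P_i` without naming a scalar — the same
  reading `…PositionSpaceFields` §15 (Y′) uses for the damping factor's «(γ^i)^N»); nonnegativity, joint continuity,
  `sliceNormPos_eq_zero_iff`; **`gPrinted A (i, α) y = |A^{i,α}(toPos y)|`** = the smeared-field datum of
  `LargeFieldRegion.Ebox` for the cut-off field (`continuous_gPrinted_uncurry`, `gPrinted_nonneg`,
  `gPrinted_add_intCast`).
* §4 **`Eprinted par N S M ε₁ lamT P Δ A`** `= E_Δ(A) = |Δ|⁻¹ ∫_Δ ((λ_i^t)^{1/2+ε₁} M^{−i} |A^{i,α}(y)|)^{P_i} dy` — (II.26)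
  OF THE CUT-OFF CONFIGURATION `A` (`Eprinted_eq`: literally, by `rfl`); `Eprinted_nonneg` (even `P_i`) /
  `Eprinted_nonneg'` (any `P_i`, nonnegative prefactor); `continuous_integrandE_uncurry`; **`measurable_Eprinted`**
  (joint measurability + Fubini: `StronglyMeasurable.integral_prod_right'`); `integrableOn_integrandE`.
  §4a′ **`Eprinted_corner_add`** (with `mem_toSet_corner_add_iff`): corners differing by a lattice PERIOD (an integer
  translation of the box) give the same `E_Δ(A)` — the functional lives on the boxes OF THE TORUS (ℤ⁴-periodicity of the
  field + translation invariance of Lebesgue measure).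
  §4b **`continuous_Eprinted`**: `A ↦ E_Δ(A)` is CONTINUOUS in the product topology (dominated convergence on the box,
  the integrand bounded near `A₀` through the continuous finite-mode majorant `sliceMajorant`, `norm_slicePos_le`,
  `sliceNormPos_le`: `|A^{i,α}(x)| ≤ √6 Σ_{p,μ,a}|κ^{i,α}Ã^a_μ(p)|`; `volume_toSet_lt_top`); `continuous_chiLFR_printedE`.
* §4c (II.29c) for the cut-off field: `backgroundField` / **`backgroundPos`** (the background multiplet `κ̃_{i′,α′} ∗ A`
  of (II.22) on Λ, `Ansatz.backgroundCutoff`), **`Bprinted_backgroundPos_eq`** (leaf 1's `Bprinted` with this datum collapses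
  to `B(Δ, x) = Σ_{(i′,α′) adm} (κ̃_{i′,α′} ∗ A)(x)`; index sign as printed, precision (ab)).
* §5 **`lintegral_ymFactor_muZero_eq_sum_LFR_printedE`**: (II.35) for the tree's `dμ_{0,ρ₁}`·`e^{(1/2)(…)}` with `E_Δ` =
  THE PRINTED (II.26) of the cut-off field (even `P_i`), `H_Δ` any measurable box functional, in `[0, ∞]`,
  unconditionally; `chiLFR_printedE_mem_Icc` (`χ_LFR(A) ∈ [0,1]`, `Σ_LFR χ_LFR(A) = 1` for every cut-off `A`);
  `measurable_chiLFR_printedE`.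
* §6 every printed symbol from the pinned carrier's `Parameters`: `lamT par i = √(par.tentativeCoupling i)` (= `λ_i^t`;
  `lamT_sq`), **`EprintedPar`** (`M = par.M`, `ε₁ = par.ε₁`), `EprintedPar_nonneg` (any power), `continuous_EprintedPar`,
  `measurable_EprintedPar`, **`lintegral_ymFactor_muZero_eq_sum_LFR_par`** ((II.35) with `τ, M, ε₁, λ_i^t, dμ_{0,ρ₁}` and the
  exponential all from `par`; `P_i`, `N_i`, the box set and `H_Δ` explicit data).

**Readings (declared).** (N) the scalar of (II.26) = the pointwise norm `|A^{i,α}(x)|` of the printed scalar product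
(p.328 tl.37–41); a component-wise or trace-power reading would be another instance of `LargeFieldRegion.Ebox`.
(ι) the time index `α ∈ ℤ` of `…PhaseCells`' boxes is passed to the `ℕ`-indexed slices of `…AnisotropicSlicing` through
`Int.toNat` (the printed range `N_i ≤ α ≤ i + 1`, p.334 tl.44–46, is nonnegative for `i ≥ |ln λ_i^t/ln M|`). (κ) `lamT i`
stands for `λ_i^t` of (II.12) — the tree's `Parameters.tentativeCoupling i` names `(λ_i^t)²`, so the model's value is
its square root; kept a parameter. (π) `P_i` as a natural number per slice (`…PhaseCells`); the printed value
`(λ_i^t)^{−ε₁/2}` is `PhaseCells.exponentP`. (τ) position space = the flat torus of `…PositionSpaceFields` (period `2π`,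
unit Haar volume) addressed through period-`1` coordinates; `E_Δ` integrates over the box `Δ ⊆ ℝ⁴` of
`PhaseCells.anisoBox` against Lebesgue measure and divides by its Lebesgue volume — «(1/Δ)∫_Δ» is an average, insensitive
to the normalisation of the volume.

**What is NOT claimed or typed.** `H_Δ` (II.29b) of the cut-off field — `B(Δ, x)` is typed (§4c) but `∇B` raised to
`P_{1,i}` needs a scalar reading of a derivative multiplet and the index range (II.29c) carries the as-printed precision (ab) of `…MRS93LargeFieldRegions` (there `Bprinted`/`Bprinted_eq` type the display
literally and collapse it; the scalar meaning of the power of the multiplet `∇B` is not printed either) — so `H_Δ`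
stays an abstract measurable functional in §5; the small-field bound «A^i < (λ_i^t)^{−1/2−ε₁}M^i» (p.339 tl.19–20) as a
consequence of `E_Δ ≤ 1` (a pointwise-vs-average statement the print does not make precise); Lemma II.1, the cluster
and Mayer expansions, anything of Sects. III–VIII; anything of Bałaban's. MRS work at FIXED INFRARED CUTOFF (p.328
tl.4–5): nothing here bears on infinite volume or a mass gap.
-/

noncomputable section

open MeasureTheory Set Real Finset Complex
open scoped ENNReal ComplexConjugate

namespace Literature.MathematicalPhysics.QuantumFieldTheory.MagnenRivasseauSeneor1993

namespace LargeFieldRegion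

open Ansatz MainStatement PositionSpace

/-! ## §1 Unit-torus coordinates: `ℝ⁴` (period-`1` coordinates of `Λ = ℝ⁴/ℤ⁴`, p.328 tl.8) → `Pos` (period `2π`) -/

/-- The point of `Λ` with period-`1` coordinates `y ∈ ℝ⁴` («the torus Λ = ℝ⁴/ℤ⁴», p.328 tl.8; the boxes of `𝐃_{i,α}`
are «refinements of a fixed lattice at the unit scale», p.335 tl.18–19), in the period-`2π` model `Pos` of
`…MRS93PositionSpaceFields`. [cite: MagnenRivasseauSeneor1993, §II.A p.328 tl.8, §II.B p.335 tl.16–19] -/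
def toPos (y : Fin 4 → ℝ) : Pos := fun μ => ((2 * Real.pi * y μ : ℝ) : AddCircle (2 * Real.pi))

/-- `toPos` is continuous. [cite: MagnenRivasseauSeneor1993, §II.A p.328 tl.8] -/
theorem continuous_toPos : Continuous toPos :=
  continuous_pi fun μ => (AddCircle.continuous_mk' (p := 2 * Real.pi)).comp (continuous_const.mul (continuous_apply μ))

/-- `toPos` is `ℤ⁴`-periodic: «Λ = ℝ⁴/ℤ⁴». [cite: MagnenRivasseauSeneor1993, §II.A p.328 tl.8] -/
theorem toPos_add_intCast (y : Fin 4 → ℝ) (n : Fin 4 → ℤ) : toPos (fun μ => y μ + n μ) = toPos y := by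
  funext μ
  simp only [toPos]
  rw [mul_add, AddCircle.coe_add]
  have h0 : ((2 * Real.pi * (n μ : ℝ) : ℝ) : AddCircle (2 * Real.pi)) = 0 :=
    (AddCircle.coe_eq_zero_iff (2 * Real.pi)).mpr ⟨n μ, by rw [zsmul_eq_mul, mul_comm]⟩
  rw [h0, add_zero]

/-! ## §2 `A^{i,α}(x)`: the anisotropic slice (II.23) of the cut-off field IN POSITION SPACE -/

variable (par : Parameters) (N : ℕ → ℕ) (S : Finset Momentum)

/-- **`A^{i,α,a}_μ(x) = Σ_{p∈S} κ^{i,α}(|p|, |p₀|) Ã^a_μ(p) e^{ip·x}`** — «A = Σ_𝐏 κ̃^{i,α} ∗ A ≡ Σ_{j∈𝐏} A^j (II.23) (where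
the tilde means the Fourier transform)» for the cut-off field on the window `S`: the Fourier synthesis
(`PositionSpace.field`) of the momentum-space block `MainStatement.sliceField` of `…MRS93AnisotropicSlicing`.
[cite: MagnenRivasseauSeneor1993, (II.23) p.335 tl.12–15, §II.A p.328 tl.12–17] -/
def slicePos (i α : ℕ) (A : Config) (μ : Fin 4) (a : Fin 3) (x : Pos) : ℂ :=
  field S (MainStatement.sliceField par N i α A) μ a x

/-- `x ↦ A^{i,α,a}_μ(x)` is continuous (a trigonometric polynomial). [cite: MagnenRivasseauSeneor1993, (II.23) p.335] -/
theorem continuous_slicePos (i α : ℕ) (A : Config) (μ : Fin 4) (a : Fin 3) :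
    Continuous (slicePos par N S i α A μ a) :=
  continuous_field S _ μ a

/-- The momentum-space block `A ↦ A^j` is continuous (mode-wise multiplication by `κ^{i,α}`).
[cite: MagnenRivasseauSeneor1993, (II.23) p.335] -/
theorem continuous_sliceField_config (i α : ℕ) :
    Continuous fun A : Config => MainStatement.sliceField par N i α A :=
  continuous_pi fun m => continuous_const.mul (continuous_apply m)

/-- `(A, x) ↦ A^{i,α,a}_μ(x)` is JOINTLY continuous (finitely many coordinates of `A` times characters).
[cite: MagnenRivasseauSeneor1993, (II.23) p.335, §II.A p.328 tl.12–17] -/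
theorem continuous_slicePos_uncurry (i α : ℕ) (μ : Fin 4) (a : Fin 3) :
    Continuous fun Ax : Config × Pos => slicePos par N S i α Ax.1 μ a Ax.2 := by
  unfold slicePos field
  refine continuous_finsetSum _ fun p _ => ?_
  exact ((continuous_coeff p μ a).comp ((continuous_sliceField_config par N i α).comp continuous_fst)).mul
    ((continuous_chi p.1).comp continuous_snd)

/-- (II.23) in position space: the synthesised field is the sum of its blocks, `A(x) = Σ_{j∈𝐏} A^j(x)` — the synthesis of
`MainStatement.fieldDecomposition`. [cite: MagnenRivasseauSeneor1993, (II.23) p.335 tl.12–15] -/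
theorem field_fieldDecomposition (ρ₁ : ℕ) (A : Config) (μ : Fin 4) (a : Fin 3) (x : Pos) :
    field S (fieldDecomposition par N ρ₁ A) μ a x = ∑ j ∈ indexFinset N ρ₁, slicePos par N S j.1 j.2 A μ a x := by
  unfold slicePos field fieldDecomposition
  rw [Finset.sum_comm]
  refine Finset.sum_congr rfl fun p _ => ?_
  rw [← Finset.sum_mul]
  congr 1
  unfold coeff
  push_cast
  rw [Finset.sum_add_distrib, Finset.sum_mul]

/-! ## §2b Reality: the slice of a real cut-off field is a real field -/

/-- `|−p₀| = |p₀|`. [cite: MagnenRivasseauSeneor1993, §II.A p.328] -/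
theorem timeAbs_neg (p : Momentum) : p.neg.timeAbs = p.timeAbs := by
  unfold Momentum.timeAbs Momentum.neg
  simp

/-- The Fourier coefficient of the block: `(A^j)~(p) = κ^{i,α}(|p|,|p₀|) · Ã(p)`.
[cite: MagnenRivasseauSeneor1993, (II.23) p.335] -/
theorem coeff_sliceField (i α : ℕ) (A : Config) (p : Momentum) (μ : Fin 4) (a : Fin 3) :
    coeff (MainStatement.sliceField par N i α A) p μ a =
      (anisoSlice par.τ par.η par.M (N i) i α p.norm p.timeAbs : ℂ) * coeff A p μ a := by
  unfold coeff MainStatement.sliceField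
  push_cast
  ring

/-- The block `A ↦ A^j` preserves the reality constraint `Ã(−p) = conj Ã(p)` (the multiplier `κ^{i,α}(|p|,|p₀|)` is real
and even in `p`). [cite: MagnenRivasseauSeneor1993, (II.23) p.335, §II.A p.328 tl.12–17] -/
theorem isRealOn_sliceField {S : Finset Momentum} {A : Config} (hA : IsRealOn S A) (i α : ℕ) :
    IsRealOn S (MainStatement.sliceField par N i α A) := by
  intro p hp
  refine ⟨(hA p hp).1, fun μ a => ?_⟩
  rw [coeff_sliceField, coeff_sliceField, Momentum.norm_neg, timeAbs_neg, (hA p hp).2 μ a, map_mul,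
    Complex.conj_ofReal]

/-- **`A^{i,α}(x)` IS REAL** for a cut-off configuration obeying the reality constraint (as `dμ_{0,ρ₁}`-almost every
configuration does on a symmetric window, `PositionSpace.ae_isRealOn_muZero`).
[cite: MagnenRivasseauSeneor1993, (II.23) p.335, §II.A p.328 tl.12–17] -/
theorem conj_slicePos {S : Finset Momentum} {A : Config} (hA : IsRealOn S A) (i α : ℕ) (μ : Fin 4) (a : Fin 3)
    (x : Pos) : conj (slicePos par N S i α A μ a x) = slicePos par N S i α A μ a x :=
  conj_field (isRealOn_sliceField par N hA i α) μ a x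

/-- … i.e. its imaginary part vanishes. [cite: MagnenRivasseauSeneor1993, (II.23) p.335] -/
theorem slicePos_im {S : Finset Momentum} {A : Config} (hA : IsRealOn S A) (i α : ℕ) (μ : Fin 4) (a : Fin 3)
    (x : Pos) : (slicePos par N S i α A μ a x).im = 0 :=
  Complex.conj_eq_iff_im.mp (conj_slicePos par N hA i α μ a x)

/-! ## §3 READING (N): the scalar «κ̃^{i,α} ∗ A» at a point = the pointwise norm in the printed scalar product -/

/-- `|A^{i,α}(x)|² := ½ Σ_μ Σ_a |A^{i,α,a}_μ(x)|²` — the pointwise squared norm in the printed scalar product («⟨A, B⟩ …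
minus a trace … a factor 1/2 in component notation», p.328 tl.37–41; as `PositionSpace.sliceNormSq` does for the
ghost slices). READING (N): (II.26) raises the multiplet `κ̃^{i,α} ∗ A` to the power `P_i` without naming a scalar; we
read `|·|`. [cite: MagnenRivasseauSeneor1993, (II.26) p.335, §II.A p.328 tl.37–41] -/
def sliceNormSqPos (i α : ℕ) (A : Config) (x : Pos) : ℝ :=
  (1 / 2) * ∑ μ, ∑ a, normSq (slicePos par N S i α A μ a x)

/-- `|A^{i,α}(x)|`. [cite: MagnenRivasseauSeneor1993, (II.26) p.335] -/
def sliceNormPos (i α : ℕ) (A : Config) (x : Pos) : ℝ := Real.sqrt (sliceNormSqPos par N S i α A x)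

/-- `0 ≤ |A^{i,α}(x)|²`. [cite: MagnenRivasseauSeneor1993, (II.26) p.335] -/
theorem sliceNormSqPos_nonneg (i α : ℕ) (A : Config) (x : Pos) : 0 ≤ sliceNormSqPos par N S i α A x :=
  mul_nonneg (by norm_num) (Finset.sum_nonneg fun _ _ => Finset.sum_nonneg fun _ _ => normSq_nonneg _)

/-- `0 ≤ |A^{i,α}(x)|`. [cite: MagnenRivasseauSeneor1993, (II.26) p.335] -/
theorem sliceNormPos_nonneg (i α : ℕ) (A : Config) (x : Pos) : 0 ≤ sliceNormPos par N S i α A x := Real.sqrt_nonneg _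

/-- `(A, x) ↦ |A^{i,α}(x)|²` is jointly continuous. [cite: MagnenRivasseauSeneor1993, (II.26) p.335] -/
theorem continuous_sliceNormSqPos_uncurry (i α : ℕ) :
    Continuous fun Ax : Config × Pos => sliceNormSqPos par N S i α Ax.1 Ax.2 := by
  unfold sliceNormSqPos
  refine continuous_const.mul (continuous_finsetSum _ fun μ _ => continuous_finsetSum _ fun a _ => ?_)
  exact Complex.continuous_normSq.comp (continuous_slicePos_uncurry par N S i α μ a)

/-- `(A, x) ↦ |A^{i,α}(x)|` is jointly continuous. [cite: MagnenRivasseauSeneor1993, (II.26) p.335] -/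
theorem continuous_sliceNormPos_uncurry (i α : ℕ) :
    Continuous fun Ax : Config × Pos => sliceNormPos par N S i α Ax.1 Ax.2 :=
  Real.continuous_sqrt.comp (continuous_sliceNormSqPos_uncurry par N S i α)

/-- `x ↦ |A^{i,α}(x)|` is continuous. [cite: MagnenRivasseauSeneor1993, (II.26) p.335] -/
theorem continuous_sliceNormPos (i α : ℕ) (A : Config) : Continuous (sliceNormPos par N S i α A) := by
  have h := (continuous_sliceNormPos_uncurry par N S i α).comp (Continuous.prodMk_right A)
  exact h

/-- `|A^{i,α}(x)| = 0` exactly where every component of the slice vanishes.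
[cite: MagnenRivasseauSeneor1993, (II.26) p.335] -/
theorem sliceNormPos_eq_zero_iff (i α : ℕ) (A : Config) (x : Pos) :
    sliceNormPos par N S i α A x = 0 ↔ ∀ μ a, slicePos par N S i α A μ a x = 0 := by
  unfold sliceNormPos sliceNormSqPos
  rw [Real.sqrt_eq_zero (mul_nonneg (by norm_num)
    (Finset.sum_nonneg fun _ _ => Finset.sum_nonneg fun _ _ => normSq_nonneg _))]
  rw [mul_eq_zero, or_iff_right (by norm_num : ¬(1 / 2 : ℝ) = 0)]
  rw [Finset.sum_eq_zero_iff_of_nonneg fun μ _ => Finset.sum_nonneg fun a _ => normSq_nonneg _]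
  simp only [Finset.mem_univ, forall_true_left]
  refine forall_congr' fun μ => ?_
  rw [Finset.sum_eq_zero_iff_of_nonneg fun a _ => normSq_nonneg _]
  simp only [Finset.mem_univ, forall_true_left, Complex.normSq_eq_zero]

/-- The smeared-field datum `g` that `LargeFieldRegion.Ebox` takes, FOR THE CUT-OFF FIELD: `g A (i, α) y = |A^{i,α}(y)|`,
`y ∈ ℝ⁴` the period-`1` coordinates of the point of `Λ` (reading: the time index `α ∈ ℤ` of `…MRS93PhaseCells` is
passed to the `ℕ`-indexed slices of `…MRS93AnisotropicSlicing` through `Int.toNat`; the printed range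
`N_i ≤ α ≤ i + 1` is nonnegative once `i ≥ |ln λ_i^t / ln M|`). [cite: MagnenRivasseauSeneor1993, (II.26) p.335, p.334 tl.44–46] -/
def gPrinted (A : Config) (j : ℕ × ℤ) (y : Fin 4 → ℝ) : ℝ := sliceNormPos par N S j.1 j.2.toNat A (toPos y)

/-- `(A, y) ↦ g A j y` is jointly continuous. [cite: MagnenRivasseauSeneor1993, (II.26) p.335] -/
theorem continuous_gPrinted_uncurry (j : ℕ × ℤ) :
    Continuous fun Ay : Config × (Fin 4 → ℝ) => gPrinted par N S Ay.1 j Ay.2 := by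
  change Continuous ((fun Ax : Config × Pos => sliceNormPos par N S j.1 j.2.toNat Ax.1 Ax.2) ∘
    fun Ay : Config × (Fin 4 → ℝ) => (Ay.1, toPos Ay.2))
  exact (continuous_sliceNormPos_uncurry par N S j.1 j.2.toNat).comp
    (continuous_fst.prodMk (continuous_toPos.comp continuous_snd))

/-- `0 ≤ g`. [cite: MagnenRivasseauSeneor1993, (II.26) p.335] -/
theorem gPrinted_nonneg (A : Config) (j : ℕ × ℤ) (y : Fin 4 → ℝ) : 0 ≤ gPrinted par N S A j y :=
  sliceNormPos_nonneg par N S _ _ A _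

/-- `g` is `ℤ⁴`-periodic in `y` (a function on `Λ = ℝ⁴/ℤ⁴`). [cite: MagnenRivasseauSeneor1993, §II.A p.328 tl.8] -/
theorem gPrinted_add_intCast (A : Config) (j : ℕ × ℤ) (y : Fin 4 → ℝ) (n : Fin 4 → ℤ) :
    gPrinted par N S A j (fun μ => y μ + n μ) = gPrinted par N S A j y := by
  unfold gPrinted; rw [toPos_add_intCast]

/-! ## §4 (II.26) FOR THE CUT-OFF FIELD: `E_Δ(A)` as a functional of the configuration -/

/-- **`E_Δ(A) = (1/|Δ|) ∫_Δ ((λ_i^t)^{1/2+ε₁} M^{−i} |A^{i,α}(x)|)^{P_i} d⁴x`** (II.26) for the box `Δ = ((i, α), k)` of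
`𝐃_{i,α}` and the cut-off field `A` on the window `S`: `LargeFieldRegion.Ebox` (= `PhaseCells.smallFieldE` on the box)
at the smeared-field datum `gPrinted`. `lamT i` = `λ_i^t` (II.12) (the model's value is the square root of
`Parameters.tentativeCoupling i`, which names `(λ_i^t)²`), `P i` = the power `P_i` read as a natural number.
[cite: MagnenRivasseauSeneor1993, (II.26) p.335 tl.23–24] -/
def Eprinted (M ε₁ : ℝ) (lamT : ℕ → ℝ) (P : ℕ → ℕ) (b : BoxLabel) (A : Config) : ℝ :=
  Ebox M ε₁ lamT P (gPrinted par N S) b A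

/-- (II.26) unfolded, literally: `E_Δ(A) = |Δ|⁻¹ ∫_Δ ((λ_i^t)^{1/2+ε₁} M^{−i} |A^{i,α}(y)|)^{P_i} dy`.
[cite: MagnenRivasseauSeneor1993, (II.26) p.335 tl.23–24] -/
theorem Eprinted_eq (M ε₁ : ℝ) (lamT : ℕ → ℝ) (P : ℕ → ℕ) (b : BoxLabel) (A : Config) :
    Eprinted par N S M ε₁ lamT P b A =
      (volume (b.toSet M)).toReal⁻¹ *
        ∫ y in b.toSet M, (lamT b.1.1 ^ (1 / 2 + ε₁) * M ^ (-(b.1.1 : ℤ)) * gPrinted par N S A b.1 y) ^ P b.1.1 :=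
  rfl

/-- `E_Δ(A) ≥ 0` for even `P_i`. [cite: MagnenRivasseauSeneor1993, (II.26) p.335] -/
theorem Eprinted_nonneg (M ε₁ : ℝ) (lamT : ℕ → ℝ) {P : ℕ → ℕ} (hP : ∀ i, Even (P i)) (b : BoxLabel) (A : Config) :
    0 ≤ Eprinted par N S M ε₁ lamT P b A :=
  Ebox_nonneg M ε₁ lamT hP _ b A

/-- `E_Δ(A) ≥ 0` for EVERY power when the prefactor is nonnegative (`λ_i^t ≥ 0`, `M ≥ 0`): the integrand is a power of
a nonnegative number. [cite: MagnenRivasseauSeneor1993, (II.26) p.335] -/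
theorem Eprinted_nonneg' {M : ℝ} (hM : 0 ≤ M) (ε₁ : ℝ) {lamT : ℕ → ℝ} (hlam : ∀ i, 0 ≤ lamT i) (P : ℕ → ℕ)
    (b : BoxLabel) (A : Config) : 0 ≤ Eprinted par N S M ε₁ lamT P b A := by
  rw [Eprinted_eq]
  refine mul_nonneg (inv_nonneg.mpr ENNReal.toReal_nonneg) (integral_nonneg fun y => pow_nonneg ?_ _)
  exact mul_nonneg (mul_nonneg (Real.rpow_nonneg (hlam _) _) (zpow_nonneg hM _)) (gPrinted_nonneg par N S A _ y)

/-- The integrand of (II.26), `(A, y) ↦ ((λ_i^t)^{1/2+ε₁} M^{−i} |A^{i,α}(y)|)^{P_i}`, is jointly continuous.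
[cite: MagnenRivasseauSeneor1993, (II.26) p.335] -/
theorem continuous_integrandE_uncurry (M ε₁ : ℝ) (lamT : ℕ → ℝ) (P : ℕ → ℕ) (j : ℕ × ℤ) :
    Continuous fun Ay : Config × (Fin 4 → ℝ) =>
      (lamT j.1 ^ (1 / 2 + ε₁) * M ^ (-(j.1 : ℤ)) * gPrinted par N S Ay.1 j Ay.2) ^ P j.1 :=
  (continuous_const.mul (continuous_gPrinted_uncurry par N S j)).pow _

/-- **`A ↦ E_Δ(A)` is a MEASURABLE functional of the configuration** (joint measurability of the integrand + Fubini
measurability of the partial integral): the hypothesis `Measurable (E Δ)` of `…MRS93LargeFieldRegions` §3 holds for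
the printed `E_Δ`. [cite: MagnenRivasseauSeneor1993, (II.26) p.335] -/
theorem measurable_Eprinted (M ε₁ : ℝ) (lamT : ℕ → ℝ) (P : ℕ → ℕ) (b : BoxLabel) :
    Measurable (Eprinted par N S M ε₁ lamT P b) := by
  have hf : StronglyMeasurable (Function.uncurry fun (A : Config) (y : Fin 4 → ℝ) =>
      (lamT b.1.1 ^ (1 / 2 + ε₁) * M ^ (-(b.1.1 : ℤ)) * gPrinted par N S A b.1 y) ^ P b.1.1) :=
    (continuous_integrandE_uncurry par N S M ε₁ lamT P b.1).measurable.stronglyMeasurable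
  have h : Measurable fun A : Config => ∫ y in b.toSet M,
      (lamT b.1.1 ^ (1 / 2 + ε₁) * M ^ (-(b.1.1 : ℤ)) * gPrinted par N S A b.1 y) ^ P b.1.1 :=
    (hf.integral_prod_right' (ν := volume.restrict (b.toSet M))).measurable
  rw [show Eprinted par N S M ε₁ lamT P b = fun A => (volume (b.toSet M)).toReal⁻¹ * ∫ y in b.toSet M,
      (lamT b.1.1 ^ (1 / 2 + ε₁) * M ^ (-(b.1.1 : ℤ)) * gPrinted par N S A b.1 y) ^ P b.1.1 from rfl]
  exact measurable_const.mul h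

/-- At fixed `A`, `y ↦` the integrand is continuous, hence integrable on the (bounded) box.
[cite: MagnenRivasseauSeneor1993, (II.26) p.335] -/
theorem integrableOn_integrandE (M ε₁ : ℝ) (lamT : ℕ → ℝ) (P : ℕ → ℕ) (b : BoxLabel) (A : Config) :
    IntegrableOn (fun y => (lamT b.1.1 ^ (1 / 2 + ε₁) * M ^ (-(b.1.1 : ℤ)) * gPrinted par N S A b.1 y) ^ P b.1.1)
      (b.toSet M) volume := by
  have hc : Continuous fun y =>
      (lamT b.1.1 ^ (1 / 2 + ε₁) * M ^ (-(b.1.1 : ℤ)) * gPrinted par N S A b.1 y) ^ P b.1.1 := by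
    have h := (continuous_integrandE_uncurry par N S M ε₁ lamT P b.1).comp (Continuous.prodMk_right A)
    exact h
  refine (hc.continuousOn.integrableOn_compact (isCompact_Icc (a := fun μ => (b.2 μ : ℝ) *
    PhaseCells.boxSide M b.1.1 b.1.2 μ) (b := fun μ => ((b.2 μ : ℝ) + 1) * PhaseCells.boxSide M b.1.1 b.1.2 μ))).mono_set
    fun y hy => ?_
  rw [BoxLabel.toSet, PhaseCells.anisoBox, Set.mem_univ_pi] at hy
  exact ⟨fun μ => (hy μ).1, fun μ => (hy μ).2.le⟩

/-! ## §4a′ `E_Δ` lives on the torus: corners differing by a lattice period give the same functional -/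

/-- Translating the corner of a box by `T` lattice units, where `T_μ · side_μ = v_μ ∈ ℤ` is an INTEGER vector, translates
the box by `v`: `y ∈ Δ_{k+T} ↔ y − v ∈ Δ_k`. [cite: MagnenRivasseauSeneor1993, §II.B p.335 tl.16–19, §II.A p.328 tl.8] -/
theorem mem_toSet_corner_add_iff (M : ℝ) (j : ℕ × ℤ) (k T v : Fin 4 → ℤ)
    (hT : ∀ μ, (T μ : ℝ) * PhaseCells.boxSide M j.1 j.2 μ = v μ) (y : Fin 4 → ℝ) :
    y ∈ BoxLabel.toSet M (j, k + T) ↔ (fun μ => y μ - v μ) ∈ BoxLabel.toSet M (j, k) := by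
  simp only [BoxLabel.toSet, PhaseCells.anisoBox, Set.mem_univ_pi, Set.mem_Ico, Pi.add_apply, Int.cast_add]
  refine forall_congr' fun μ => ?_
  rw [← hT μ]
  constructor <;> rintro ⟨h1, h2⟩ <;> constructor <;> nlinarith

/-- **`E_Δ` is a functional of the box ON THE TORUS**: two corners that differ by a lattice period (an integer translation of
the box in `ℝ⁴`) give the same `E_Δ(A)` — the cut-off field is `ℤ⁴`-periodic and Lebesgue measure is translation
invariant; so at scale `(i, α)` only the `M^{3i+α}` boxes of the unit cell count (`M` an integer, «refinements of a fixed
lattice at the unit scale», p.335 tl.18–19). [cite: MagnenRivasseauSeneor1993, §II.B (II.26) p.335, p.335 tl.16–19, §II.A p.328 tl.8] -/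
theorem Eprinted_corner_add {M : ℝ} (hM : 0 < M) (ε₁ : ℝ) (lamT : ℕ → ℝ) (P : ℕ → ℕ) (j : ℕ × ℤ) (k T v : Fin 4 → ℤ)
    (hT : ∀ μ, (T μ : ℝ) * PhaseCells.boxSide M j.1 j.2 μ = v μ) (A : Config) :
    Eprinted par N S M ε₁ lamT P (j, k + T) A = Eprinted par N S M ε₁ lamT P (j, k) A := by
  rw [Eprinted_eq, Eprinted_eq]
  have hvol : (volume (BoxLabel.toSet M (j, k + T))).toReal = (volume (BoxLabel.toSet M (j, k))).toReal := by
    simp only [BoxLabel.toSet]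
    rw [PhaseCells.volume_anisoBox hM, PhaseCells.volume_anisoBox hM]
  rw [hvol]
  congr 1
  set F : (Fin 4 → ℝ) → ℝ := fun y => (lamT j.1 ^ (1 / 2 + ε₁) * M ^ (-(j.1 : ℤ)) * gPrinted par N S A j y) ^ P j.1
    with hF
  set w : Fin 4 → ℝ := fun μ => (v μ : ℝ) with hw
  have hper : ∀ y, F (y + w) = F y := fun y => by
    have e : gPrinted par N S A j (y + w) = gPrinted par N S A j y := by
      have : y + w = fun μ => y μ + (v μ : ℝ) := by funext μ; rfl
      rw [this, gPrinted_add_intCast]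
    simp only [hF, e]
  have hmeas1 : MeasurableSet (BoxLabel.toSet M (j, k + T)) := PhaseCells.measurableSet_anisoBox M _ _ _
  have hmeas0 : MeasurableSet (BoxLabel.toSet M (j, k)) := PhaseCells.measurableSet_anisoBox M _ _ _
  have hind : ∀ y, (BoxLabel.toSet M (j, k + T)).indicator F (y + w) = (BoxLabel.toSet M (j, k)).indicator F y := by
    intro y
    have hmem : y + w ∈ BoxLabel.toSet M (j, k + T) ↔ y ∈ BoxLabel.toSet M (j, k) := by
      rw [mem_toSet_corner_add_iff M j k T v hT]
      have : (fun μ => (y + w) μ - (v μ : ℝ)) = y := by funext μ; simp [hw]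
      rw [this]
    by_cases hy : y ∈ BoxLabel.toSet M (j, k)
    · rw [Set.indicator_of_mem (hmem.mpr hy), Set.indicator_of_mem hy, hper]
    · rw [Set.indicator_of_notMem (fun h => hy (hmem.mp h)), Set.indicator_of_notMem hy]
  calc ∫ y in BoxLabel.toSet M (j, k + T), F y
      = ∫ y, (BoxLabel.toSet M (j, k + T)).indicator F y := (integral_indicator hmeas1).symm
    _ = ∫ y, (BoxLabel.toSet M (j, k + T)).indicator F (y + w) := (integral_add_right_eq_self _ w).symm
    _ = ∫ y, (BoxLabel.toSet M (j, k)).indicator F y := by simp_rw [hind]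
    _ = ∫ y in BoxLabel.toSet M (j, k), F y := integral_indicator hmeas0

/-! ## §4b `A ↦ E_Δ(A)` is CONTINUOUS (dominated convergence against a finite-mode majorant) -/

/-- A majorant of the slice depending on finitely many coordinates of the configuration:
`Σ_{p∈S} Σ_μ Σ_a |κ^{i,α} Ã^a_μ(p)|`. [cite: MagnenRivasseauSeneor1993, (II.23) p.335] -/
def sliceMajorant (i α : ℕ) (A : Config) : ℝ := ∑ p ∈ S, ∑ μ, ∑ a, ‖coeff (MainStatement.sliceField par N i α A) p μ a‖

/-- The majorant is a continuous function of the configuration. [cite: MagnenRivasseauSeneor1993, (II.23) p.335] -/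
theorem continuous_sliceMajorant (i α : ℕ) : Continuous (sliceMajorant par N S i α) := by
  unfold sliceMajorant
  refine continuous_finsetSum _ fun p _ => continuous_finsetSum _ fun μ _ => continuous_finsetSum _ fun a _ => ?_
  exact continuous_norm.comp ((continuous_coeff p μ a).comp (continuous_sliceField_config par N i α))

/-- `0 ≤` the majorant. [cite: MagnenRivasseauSeneor1993, (II.23) p.335] -/
theorem sliceMajorant_nonneg (i α : ℕ) (A : Config) : 0 ≤ sliceMajorant par N S i α A :=
  Finset.sum_nonneg fun _ _ => Finset.sum_nonneg fun _ _ => Finset.sum_nonneg fun _ _ => norm_nonneg _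

/-- `|A^{i,α,a}_μ(x)| ≤ Σ_p |κ^{i,α} Ã^a_μ(p)|` (`|e^{ip·x}| = 1`), hence `≤` the majorant, uniformly in `x`.
[cite: MagnenRivasseauSeneor1993, (II.23) p.335, §II.A p.328 tl.12–17] -/
theorem norm_slicePos_le (i α : ℕ) (A : Config) (μ : Fin 4) (a : Fin 3) (x : Pos) :
    ‖slicePos par N S i α A μ a x‖ ≤ sliceMajorant par N S i α A := by
  unfold slicePos field sliceMajorant
  refine (norm_sum_le _ _).trans (Finset.sum_le_sum fun p _ => ?_)
  rw [norm_mul, norm_chi, mul_one]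
  refine (Finset.single_le_sum (f := fun μ' => ∑ a', ‖coeff (MainStatement.sliceField par N i α A) p μ' a'‖)
    (fun _ _ => Finset.sum_nonneg fun _ _ => norm_nonneg _) (Finset.mem_univ μ)).trans' ?_
  exact Finset.single_le_sum (f := fun a' => ‖coeff (MainStatement.sliceField par N i α A) p μ a'‖)
    (fun _ _ => norm_nonneg _) (Finset.mem_univ a)

/-- `|A^{i,α}(x)| ≤ √6 · majorant` (twelve components, the factor `1/2`). [cite: MagnenRivasseauSeneor1993, (II.26) p.335] -/
theorem sliceNormPos_le (i α : ℕ) (A : Config) (x : Pos) :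
    sliceNormPos par N S i α A x ≤ Real.sqrt 6 * sliceMajorant par N S i α A := by
  have hm := sliceMajorant_nonneg par N S i α A
  have hsq : sliceNormSqPos par N S i α A x ≤ 6 * sliceMajorant par N S i α A ^ 2 := by
    unfold sliceNormSqPos
    have hterm : ∀ μ a, normSq (slicePos par N S i α A μ a x) ≤ sliceMajorant par N S i α A ^ 2 := fun μ a => by
      rw [Complex.normSq_eq_norm_sq]
      exact pow_le_pow_left₀ (norm_nonneg _) (norm_slicePos_le par N S i α A μ a x) 2
    calc (1 / 2 : ℝ) * ∑ μ, ∑ a, normSq (slicePos par N S i α A μ a x)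
        ≤ (1 / 2) * ∑ _μ : Fin 4, ∑ _a : Fin 3, sliceMajorant par N S i α A ^ 2 := by
          gcongr with μ _ a _
          exact hterm μ a
      _ = 6 * sliceMajorant par N S i α A ^ 2 := by simp; ring
  unfold sliceNormPos
  calc Real.sqrt (sliceNormSqPos par N S i α A x) ≤ Real.sqrt (6 * sliceMajorant par N S i α A ^ 2) :=
        Real.sqrt_le_sqrt hsq
    _ = Real.sqrt 6 * sliceMajorant par N S i α A := by
        rw [Real.sqrt_mul (by norm_num), Real.sqrt_sq hm]

/-- The box has finite volume (it lies in a compact box). [cite: MagnenRivasseauSeneor1993, §II.B p.335 tl.16–19] -/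
theorem volume_toSet_lt_top (M : ℝ) (b : BoxLabel) : volume (b.toSet M) < ⊤ := by
  refine lt_of_le_of_lt (measure_mono ?_) (isCompact_Icc (a := fun μ => (b.2 μ : ℝ) *
    PhaseCells.boxSide M b.1.1 b.1.2 μ) (b := fun μ => ((b.2 μ : ℝ) + 1) * PhaseCells.boxSide M b.1.1 b.1.2 μ)).measure_lt_top
  intro y hy
  rw [BoxLabel.toSet, PhaseCells.anisoBox, Set.mem_univ_pi] at hy
  exact ⟨fun μ => (hy μ).1, fun μ => (hy μ).2.le⟩

/-- **`A ↦ E_Δ(A)` is a CONTINUOUS functional of the cut-off configuration** (product topology): dominated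
convergence on the box, the integrand being bounded near `A₀` through the continuous finite-mode majorant. So the
printed `E_Δ` meets the hypothesis of `LargeFieldRegion.continuous_chiLFR` as well.
[cite: MagnenRivasseauSeneor1993, (II.26) p.335] -/
theorem continuous_Eprinted (M ε₁ : ℝ) (lamT : ℕ → ℝ) (P : ℕ → ℕ) (b : BoxLabel) :
    Continuous (Eprinted par N S M ε₁ lamT P b) := by
  set c : ℝ := lamT b.1.1 ^ (1 / 2 + ε₁) * M ^ (-(b.1.1 : ℤ)) with hc
  rw [show Eprinted par N S M ε₁ lamT P b = fun A => (volume (b.toSet M)).toReal⁻¹ * ∫ y in b.toSet M,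
      (c * gPrinted par N S A b.1 y) ^ P b.1.1 from rfl]
  refine continuous_const.mul (continuous_iff_continuousAt.mpr fun A₀ => ?_)
  have hF : Continuous fun Ay : Config × (Fin 4 → ℝ) => (c * gPrinted par N S Ay.1 b.1 Ay.2) ^ P b.1.1 :=
    continuous_integrandE_uncurry par N S M ε₁ lamT P b.1
  haveI : IsFiniteMeasure (volume.restrict (b.toSet M)) := isFiniteMeasure_restrict.mpr (volume_toSet_lt_top M b).ne
  have hmaj : ∀ᶠ A in nhds A₀,
      sliceMajorant par N S b.1.1 b.1.2.toNat A < sliceMajorant par N S b.1.1 b.1.2.toNat A₀ + 1 :=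
    (continuous_sliceMajorant par N S b.1.1 b.1.2.toNat).continuousAt.eventually_lt continuousAt_const
      (by linarith)
  refine continuousAt_of_dominated
    (bound := fun _ => (|c| * (Real.sqrt 6 * (sliceMajorant par N S b.1.1 b.1.2.toNat A₀ + 1))) ^ P b.1.1)
    (Filter.Eventually.of_forall fun A => ?_) ?_ (integrable_const _) (ae_of_all _ fun y => ?_)
  · have hA : Continuous fun y : Fin 4 → ℝ => (c * gPrinted par N S A b.1 y) ^ P b.1.1 := by
      have h := hF.comp (Continuous.prodMk_right A)
      exact h
    exact hA.aestronglyMeasurable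
  · filter_upwards [hmaj] with A hA
    refine ae_of_all _ fun y => ?_
    rw [Real.norm_eq_abs, abs_pow, abs_mul, abs_of_nonneg (gPrinted_nonneg par N S A b.1 y)]
    refine pow_le_pow_left₀ (mul_nonneg (abs_nonneg _) (gPrinted_nonneg par N S A b.1 y))
      (mul_le_mul_of_nonneg_left ?_ (abs_nonneg _)) _
    exact (sliceNormPos_le par N S b.1.1 b.1.2.toNat A (toPos y)).trans
      (mul_le_mul_of_nonneg_left hA.le (Real.sqrt_nonneg _))
  · have hy : Continuous fun A : Config => (c * gPrinted par N S A b.1 y) ^ P b.1.1 := by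
      have h := hF.comp (Continuous.prodMk_left y)
      exact h
    exact hy.continuousAt

/-- Hence `χ_LFR` with the printed `E_Δ` (and continuous `H_Δ`) is a continuous function of the cut-off configuration.
[cite: MagnenRivasseauSeneor1993, §II.B p.339 tl.9–10, (II.26) p.335] -/
theorem continuous_chiLFR_printedE (Pτ : CutoffProfile) (M ε₁ : ℝ) (lamT : ℕ → ℝ) (P : ℕ → ℕ)
    {𝓓 : Finset BoxLabel} {H : BoxLabel → Config → ℝ} (hH : ∀ Δ ∈ 𝓓, Continuous (H Δ)) {D₁ D₂ : Finset BoxLabel}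
    (hD₁ : D₁ ⊆ 𝓓) (hD₂ : D₂ ⊆ 𝓓) : Continuous (chiLFR Pτ 𝓓 (Eprinted par N S M ε₁ lamT P) H D₁ D₂) :=
  continuous_chiLFR Pτ (fun Δ _ => continuous_Eprinted par N S M ε₁ lamT P Δ) hH hD₁ hD₂

/-! ## §4c (II.29c) FOR THE CUT-OFF FIELD: the background fields `κ̃_{i′,α′} ∗ A` on Λ and `B(Δ, x)` collapsed -/

/-- The momentum-space background block of the pair `j′ = (i′, α′)`: `κ_{j′}(|p|, |p₀|) Ã(p)` with `κ_{j′} = Σ_{j″<j′} κ^{j″}`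
of (II.22) (`Ansatz.backgroundCutoff`, «the low or background frequencies (relative to the pair j)»).
[cite: MagnenRivasseauSeneor1993, (II.22) p.335 tl.7–11] -/
def backgroundField (ρ₁ : ℕ) (j : ℕ × ℕ) (A : Config) : Config := fun m =>
  backgroundCutoff par.τ par.η par.M N ρ₁ j m.1.norm m.1.timeAbs * A m

/-- **`(κ̃_{i′,α′} ∗ A)(x)`** — the background field of the pair `(i′, α′)` IN POSITION SPACE, as a multiplet
`(μ, a) ↦ Σ_{p∈S} κ_{(i′,α′)}(|p|,|p₀|) Ã^a_μ(p) e^{ip·x}`. [cite: MagnenRivasseauSeneor1993, (II.22) p.335 tl.7–11, (II.29c) p.337] -/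
def backgroundPos (ρ₁ : ℕ) (j : ℕ × ℕ) (A : Config) (x : Pos) : Fin 4 → Fin 3 → ℂ := fun μ a =>
  field S (backgroundField par N ρ₁ j A) μ a x

/-- `x ↦ (κ̃_{j′} ∗ A)^a_μ(x)` is continuous. [cite: MagnenRivasseauSeneor1993, (II.22)–(II.23) p.335] -/
theorem continuous_backgroundPos_apply (ρ₁ : ℕ) (j : ℕ × ℕ) (A : Config) (μ : Fin 4) (a : Fin 3) :
    Continuous fun x => backgroundPos par N S ρ₁ j A x μ a :=
  continuous_field S _ μ a

/-- **(II.29c) FOR THE CUT-OFF FIELD, AS PRINTED and COLLAPSED**: with the background multiplets of the cut-off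
configuration `A` as the datum `bg` of `LargeFieldRegion.Bprinted` (index pairs of a finite set `Jset` of natural pairs,
`(i′, α′) ↦ (i′, ↑α′)` to label the lattices), the printed sum over boxes `Δ′ ∋ x` equals the finite sum of the
background fields over the admissible pairs: `B(Δ, x) = Σ_{(i′,α′)∈Jset : r(Δ) > r(i′,α′) − k(Δ)} (κ̃_{i′,α′} ∗ A)(x)`
(`M > 0`; index sign as printed — precision (ab) of `…MRS93LargeFieldRegions`).
[cite: MagnenRivasseauSeneor1993, (II.29c) p.337 tl.18–21 with (II.22) p.335] -/
theorem Bprinted_backgroundPos_eq {M : ℝ} (hM : 0 < M) (kΔ : ℝ) (ρ₁ : ℕ) (Jset : Finset (ℕ × ℕ)) (A : Config)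
    (Δ : BoxLabel) (y : Fin 4 → ℝ) :
    Bprinted M kΔ (Jset.image fun j => (j.1, (j.2 : ℤ)))
        (fun j' y' => backgroundPos par N S ρ₁ (j'.1, j'.2.toNat) A (toPos y')) Δ y =
      ∑ j' ∈ (Jset.image fun j => (j.1, (j.2 : ℤ))) with PhaseCells.rIndex j'.1 j'.2 - kΔ < Δ.r,
        backgroundPos par N S ρ₁ (j'.1, j'.2.toNat) A (toPos y) :=
  Bprinted_eq hM kΔ _ _ Δ y

/-! ## §5 (II.35) with the PRINTED `E_Δ` of the cut-off field -/

/-- **(II.35) p.339 for the tree's `dμ_{0,ρ₁}`·exponential with `E_Δ` = (II.26) OF THE CUT-OFF FIELD** (even powers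
`P_i`; `H_Δ` any measurable box functional — the reading of (II.29c) is open, precision (ab) of
`…MRS93LargeFieldRegions`): `∫ e^{(1/2)(…)} dμ_{0,ρ₁} = Σ_LFR ∫ χ_LFR e^{(1/2)(…)} dμ_{0,ρ₁}` in `[0, ∞]`, unconditionally.
[cite: MagnenRivasseauSeneor1993, §II.B (II.35) p.339 tl.11–14 with (II.26) p.335, (II.18) p.332 tl.16–21] -/
theorem lintegral_ymFactor_muZero_eq_sum_LFR_printedE (lam : ℝ) (ρ₁ : ℕ) (M ε₁ : ℝ) (lamT : ℕ → ℝ) {P : ℕ → ℕ}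
    (hP : ∀ i, Even (P i)) (𝓓 : Finset BoxLabel) {H : BoxLabel → Config → ℝ} (hH : ∀ Δ ∈ 𝓓, Measurable (H Δ)) :
    ∫⁻ A, ENNReal.ofReal (ymFactor S par lam ρ₁ A) ∂(muZero par ρ₁) =
      ∑ D₁ ∈ 𝓓.powerset, ∑ D₂ ∈ 𝓓.powerset,
        ∫⁻ A, ENNReal.ofReal (chiLFR par.τ 𝓓 (Eprinted par N S M ε₁ lamT P) H D₁ D₂ A * ymFactor S par lam ρ₁ A)
          ∂(muZero par ρ₁) :=
  lintegral_ymFactor_muZero_eq_sum_LFR S par lam ρ₁ (fun Δ _ => measurable_Eprinted par N S M ε₁ lamT P Δ) hH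
    fun Δ _ A => Eprinted_nonneg par N S M ε₁ lamT hP Δ A

/-- The weights with the printed `E_Δ` form a partition of unity on configuration space: `χ_LFR(A) ∈ [0, 1]` and
`Σ_LFR χ_LFR(A) = 1` for every cut-off configuration `A`. [cite: MagnenRivasseauSeneor1993, §II.B (II.35) p.339, (II.26) p.335] -/
theorem chiLFR_printedE_mem_Icc (Pτ : CutoffProfile) (M ε₁ : ℝ) (lamT : ℕ → ℝ) {P : ℕ → ℕ} (hP : ∀ i, Even (P i))
    (H : BoxLabel → Config → ℝ) (𝓓 D₁ D₂ : Finset BoxLabel) (A : Config) :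
    chiLFR Pτ 𝓓 (Eprinted par N S M ε₁ lamT P) H D₁ D₂ A ∈ Set.Icc (0 : ℝ) 1 ∧
      ∑ D₁' ∈ 𝓓.powerset, ∑ D₂' ∈ 𝓓.powerset, chiLFR Pτ 𝓓 (Eprinted par N S M ε₁ lamT P) H D₁' D₂' A = 1 :=
  ⟨⟨chiLFR_nonneg Pτ D₂ H fun Δ _ => Eprinted_nonneg par N S M ε₁ lamT hP Δ A,
    chiLFR_le_one Pτ D₂ H (fun Δ _ => Eprinted_nonneg par N S M ε₁ lamT hP Δ A)
      fun Δ _ => Eprinted_nonneg par N S M ε₁ lamT hP Δ A⟩,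
    sum_sum_chiLFR_eq_one Pτ 𝓓 _ _ A⟩

/-- Each `χ_LFR` with the printed `E_Δ` is a measurable function of the configuration (for measurable `H_Δ`).
[cite: MagnenRivasseauSeneor1993, §II.B p.339 tl.9–10, (II.26) p.335] -/
theorem measurable_chiLFR_printedE (Pτ : CutoffProfile) (M ε₁ : ℝ) (lamT : ℕ → ℝ) (P : ℕ → ℕ)
    {𝓓 : Finset BoxLabel} {H : BoxLabel → Config → ℝ} (hH : ∀ Δ ∈ 𝓓, Measurable (H Δ)) {D₁ D₂ : Finset BoxLabel}
    (hD₁ : D₁ ⊆ 𝓓) (hD₂ : D₂ ⊆ 𝓓) : Measurable (chiLFR Pτ 𝓓 (Eprinted par N S M ε₁ lamT P) H D₁ D₂) :=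
  measurable_chiLFR Pτ (fun Δ _ => measurable_Eprinted par N S M ε₁ lamT P Δ) hH hD₁ hD₂


/-! ## §6 Every printed symbol from the pinned carrier's `Parameters` -/

/-- `λ_i^t` itself: the square root of `Parameters.tentativeCoupling i` (which names `(λ_i^t)²` of (II.12)).
[cite: MagnenRivasseauSeneor1993, (II.12) p.330 tl.26–27] -/
def lamT (i : ℕ) : ℝ := Real.sqrt (par.tentativeCoupling i)

/-- `λ_i^t ≥ 0`. [cite: MagnenRivasseauSeneor1993, (II.12) p.330] -/
theorem lamT_nonneg (i : ℕ) : 0 ≤ lamT par i := Real.sqrt_nonneg _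

/-- `(λ_i^t)² = Parameters.tentativeCoupling i` whenever the latter is nonnegative (the printed regime of (II.12), `C`
large). [cite: MagnenRivasseauSeneor1993, (II.12) p.330 tl.26–27] -/
theorem lamT_sq {i : ℕ} (h : 0 ≤ par.tentativeCoupling i) : lamT par i ^ 2 = par.tentativeCoupling i :=
  Real.sq_sqrt h

/-- **(II.26) with every printed symbol taken from the carrier's `Parameters`**: `M = par.M`, `ε₁ = par.ε₁`,
`λ_i^t = √(par.tentativeCoupling i)`; the powers `P_i` (read as naturals) and the bottom indices `N_i` of 𝐏 remain the
explicit data they are in `…MRS93PhaseCells` / `…MRS93AnisotropicSlicing`. [cite: MagnenRivasseauSeneor1993, (II.26) p.335 tl.23–24] -/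
def EprintedPar (P : ℕ → ℕ) (b : BoxLabel) (A : Config) : ℝ :=
  Eprinted par N S (par.M : ℝ) par.ε₁ (lamT par) P b A

/-- `E_Δ ≥ 0` for the carrier's parameters, for EVERY power (`M ≥ 2 > 0`, `λ_i^t = √· ≥ 0`).
[cite: MagnenRivasseauSeneor1993, (II.26) p.335] -/
theorem EprintedPar_nonneg (P : ℕ → ℕ) (b : BoxLabel) (A : Config) : 0 ≤ EprintedPar par N S P b A :=
  Eprinted_nonneg' par N S (by exact_mod_cast (Nat.zero_le par.M)) par.ε₁ (lamT_nonneg par) P b A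

/-- `A ↦ E_Δ(A)` continuous, carrier's parameters. [cite: MagnenRivasseauSeneor1993, (II.26) p.335] -/
theorem continuous_EprintedPar (P : ℕ → ℕ) (b : BoxLabel) : Continuous (EprintedPar par N S P b) :=
  continuous_Eprinted par N S _ _ _ P b

/-- `A ↦ E_Δ(A)` measurable, carrier's parameters. [cite: MagnenRivasseauSeneor1993, (II.26) p.335] -/
theorem measurable_EprintedPar (P : ℕ → ℕ) (b : BoxLabel) : Measurable (EprintedPar par N S P b) :=
  measurable_Eprinted par N S _ _ _ P b

/-- **(II.35) for the pinned carrier's own data**: `dμ_{0,ρ₁}` = `muZero par ρ₁`, the exponential = `ymFactor S par lam ρ₁`,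
`τ = par.τ`, `E_Δ` = (II.26) of the cut-off field with `M, ε₁, λ_i^t` from `par` (any powers `P_i`), `H_Δ` any measurable
box functional: `∫ e^{(1/2)(…)} dμ_{0,ρ₁} = Σ_LFR ∫ χ_LFR e^{(1/2)(…)} dμ_{0,ρ₁}` in `[0, ∞]`.
[cite: MagnenRivasseauSeneor1993, §II.B (II.35) p.339 tl.11–14 with (II.26) p.335, (II.18) p.332 tl.16–21] -/
theorem lintegral_ymFactor_muZero_eq_sum_LFR_par (lam : ℝ) (ρ₁ : ℕ) (P : ℕ → ℕ) (𝓓 : Finset BoxLabel)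
    {H : BoxLabel → Config → ℝ} (hH : ∀ Δ ∈ 𝓓, Measurable (H Δ)) :
    ∫⁻ A, ENNReal.ofReal (ymFactor S par lam ρ₁ A) ∂(muZero par ρ₁) =
      ∑ D₁ ∈ 𝓓.powerset, ∑ D₂ ∈ 𝓓.powerset,
        ∫⁻ A, ENNReal.ofReal (chiLFR par.τ 𝓓 (EprintedPar par N S P) H D₁ D₂ A * ymFactor S par lam ρ₁ A)
          ∂(muZero par ρ₁) :=
  lintegral_ymFactor_muZero_eq_sum_LFR S par lam ρ₁ (fun Δ _ => measurable_EprintedPar par N S P Δ) hH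
    fun Δ _ A => EprintedPar_nonneg par N S P Δ A

end LargeFieldRegion

end Literature.MathematicalPhysics.QuantumFieldTheory.MagnenRivasseauSeneor1993
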